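import Summits.AtomisticToContinuum.Crystallization.Theorems.TwoCentreKissingKernelRobustTangencyBoundCornerSplit
import HarnessLib

/-!
# `RobustTangencyBound` — the convexity inequality across a facet, in Gram form (step (III), blueprint §14)

Route `TwoCentreKissingKernel`, item `stmt-AtomisticToContinuum-12082`.  Let `c` be a facet
normal of `conv X` and `p, q, r` three distinct tight points of `c`.  For every `x ∈ X`,
`⟪c, x⟫ ≤ 1` (the hull lies below the facet plane).  Writing `G` for the Gram matrix of
`p, q, r` and `g = (⟪p,x⟫, ⟪q,x⟫, ⟪r,x⟫)`, one has `det G · ⟪c, x⟫ = 𝟙ᵀ adj(G) g` and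
`det G = det[p;q;r]² ≥ 0`, hence the polynomial inequality
`cvxForm … = det G − 𝟙ᵀ adj(G) g ≥ 0` in the inner products alone (`convexity_gram`).  Applied to
the far apex of the neighbouring facet across a long edge, this is the CONVEXITY constraint that the
certificate systems of the factory were missing; numerically it shrinks the uncertified count
lists dramatically (e.g. a rhombus diagonal endpoint can never be completed by regular triangles
alone).
-/

noncomputable section

namespace Summit.AtomisticToContinuum.Crystallization.Theorems

open Real RealInnerProductSpace InnerProductGeometry Literature.Geometry.DiscreteGeometry
  Literature.Analysis.ValidatedNumerics Finset

/-- The convexity form: `det G − 𝟙ᵀ adj(G) g` for the Gram matrix `G` of three unit vectors with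
mutual inner products `a = ⟪p,q⟫, b = ⟪p,r⟫, d = ⟪q,r⟫` and `g = (g₁, g₂, g₃)`. -/
def cvxForm (a b d g₁ g₂ g₃ : ℝ) : ℝ :=
  (1 * (1 * 1 - d * d) - a * (a * 1 - d * b) + b * (a * d - 1 * b)) -
    (((1 * 1 - d * d) + (d * b - a * 1) + (a * d - 1 * b)) * g₁ +
      ((b * d - a * 1) + (1 * 1 - b * b) + (a * b - 1 * d)) * g₂ +
      ((a * d - b * 1) + (b * a - 1 * d) + (1 * 1 - a * a)) * g₃)

/-- The inner product of `ℝ³` in coordinates. -/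
theorem inner_fin3' (x y : EuclideanSpace ℝ (Fin 3)) : ⟪x, y⟫ = x 0 * y 0 + x 1 * y 1 + x 2 * y 2 := by
  simp [PiLp.inner_apply, Fin.sum_univ_three, mul_comm]

/-- The Gram determinant of three vectors of `ℝ³` is the square of their determinant. -/
theorem gram_det_eq_orient3_sq (p q r : EuclideanSpace ℝ (Fin 3)) :
    ⟪p, p⟫ * (⟪q, q⟫ * ⟪r, r⟫ - ⟪q, r⟫ * ⟪q, r⟫) - ⟪p, q⟫ * (⟪p, q⟫ * ⟪r, r⟫ - ⟪q, r⟫ * ⟪p, r⟫) +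
        ⟪p, r⟫ * (⟪p, q⟫ * ⟪q, r⟫ - ⟪q, q⟫ * ⟪p, r⟫) = orient3 p q r ^ 2 := by
  simp only [inner_fin3', orient3]
  ring

/-- **The convexity inequality in Gram form.** For a facet normal `c`, three distinct tight points
`p, q, r` and any `x ∈ X`: `0 ≤ cvxForm ⟪p,q⟫ ⟪p,r⟫ ⟪q,r⟫ ⟪p,x⟫ ⟪q,x⟫ ⟪r,x⟫`. -/
theorem convexity_gram {X : Finset (EuclideanSpace ℝ (Fin 3))} (hX1 : ∀ z ∈ X, ‖z‖ = 1)
    {c p q r x : EuclideanSpace ℝ (Fin 3)} (hcF : c ∈ facetNormals X)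
    (hp : p ∈ tightSet X c) (hq : q ∈ tightSet X c) (hr : r ∈ tightSet X c)
    (hpq : p ≠ q) (hpr : p ≠ r) (hqr : q ≠ r) (hx : x ∈ X) :
    0 ≤ cvxForm ⟪p, q⟫ ⟪p, r⟫ ⟪q, r⟫ ⟪p, x⟫ ⟪q, x⟫ ⟪r, x⟫ := by
  classical
  -- facet data
  have hcle : ⟪c, x⟫ ≤ 1 := (mem_facetNormals.1 hcF).1 x hx
  have hcp : ⟪c, p⟫ = 1 := (mem_tightSet.1 hp).2
  have hcq : ⟪c, q⟫ = 1 := (mem_tightSet.1 hq).2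
  have hcr : ⟪c, r⟫ = 1 := (mem_tightSet.1 hr).2
  have hp1 : ⟪p, p⟫ = 1 := by rw [real_inner_self_eq_norm_sq, hX1 p (mem_tightSet.1 hp).1]; norm_num
  have hq1 : ⟪q, q⟫ = 1 := by rw [real_inner_self_eq_norm_sq, hX1 q (mem_tightSet.1 hq).1]; norm_num
  have hr1 : ⟪r, r⟫ = 1 := by rw [real_inner_self_eq_norm_sq, hX1 r (mem_tightSet.1 hr).1]; norm_num
  -- the determinant of p, q, r is nonzero (three distinct vertices of a strictly convex polygonal cone)
  set hc := ne_zero_of_mem_facetNormals hX1 hcF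
  set m := (facetAngles X c hc).card with hm
  set v := facetVertex X c hc with hvdef
  have hwor : ∀ i j k, i < j → j < k → k < m → 0 < orient3 (v i) (v j) (v k) :=
    fun i j k hij hjk hk => orient3_facetVertex_pos hX1 hcF hij hjk hk
  have hinj : ∀ i i', i < m → i' < m → v i = v i' → i = i' :=
    fun i i' hi hi' h => facetVertex_injOn hc (by rw [Finset.coe_range, Set.mem_Iio]; exact hi)
      (by rw [Finset.coe_range, Set.mem_Iio]; exact hi') h
  obtain ⟨i, hi, hip⟩ := exists_facetVertex_eq hX1 hc hp
  obtain ⟨j, hj, hjq⟩ := exists_facetVertex_eq hX1 hc hq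
  obtain ⟨k, hk, hkr⟩ := exists_facetVertex_eq hX1 hc hr
  have hij : i ≠ j := fun h => hpq (by rw [← hip, ← hjq]; exact congrArg v h)
  have hik : i ≠ k := fun h => hpr (by rw [← hip, ← hkr]; exact congrArg v h)
  have hjk : j ≠ k := fun h => hqr (by rw [← hjq, ← hkr]; exact congrArg v h)
  have hD : orient3 p q r ≠ 0 := by
    have hvi : v i = p := hip
    have hvj : v j = q := hjq
    have hvk : v k = r := hkr
    rw [← hvi, ← hvj, ← hvk]
    -- either (i,j,k) or (i,k,j) is cyclically ordered
    rcases lt_trichotomy i j with h1 | h1 | h1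
    · rcases lt_trichotomy j k with h2 | h2 | h2
      · exact (hwor i j k h1 h2 hk).ne'
      · exact absurd h2 hjk
      · rcases lt_trichotomy i k with h3 | h3 | h3
        · rw [orient3_swap_right]; exact neg_ne_zero.2 (hwor i k j h3 h2 hj).ne'
        · exact absurd h3 hik
        · rw [orient3_cyclic, orient3_cyclic]; exact (hwor k i j h3 h1 hj).ne'
    · exact absurd h1 hij
    · rcases lt_trichotomy i k with h3 | h3 | h3
      · -- j < i < k
        rw [orient3_swap_right, orient3_cyclic, orient3_cyclic]
        exact neg_ne_zero.2 (hwor j i k h1 h3 hk).ne'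
      · exact absurd h3 hik
      · rcases lt_trichotomy j k with h2 | h2 | h2
        · -- j < k < i
          rw [orient3_cyclic]; exact (hwor j k i h2 h3 hi).ne'
        · exact absurd h2 hjk
        · -- k < j < i
          rw [orient3_swap_right, orient3_cyclic]
          exact neg_ne_zero.2 (hwor k j i h2 h1 hi).ne'
  -- Cramer: D • c = o₁ • p + o₂ • q + o₃ • r
  have hexp := orient3_expand p q r c
  set D := orient3 p q r with hDdef
  set o₁ := orient3 c q r
  set o₂ := orient3 p c r
  set o₃ := orient3 p q c
  have e1 : D * 1 = o₁ * ⟪p, p⟫ + o₂ * ⟪q, p⟫ + o₃ * ⟪r, p⟫ := by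
    have := congrArg (fun w => ⟪w, p⟫) hexp
    simpa only [real_inner_smul_left, inner_add_left, hcp] using this
  have e2 : D * 1 = o₁ * ⟪p, q⟫ + o₂ * ⟪q, q⟫ + o₃ * ⟪r, q⟫ := by
    have := congrArg (fun w => ⟪w, q⟫) hexp
    simpa only [real_inner_smul_left, inner_add_left, hcq] using this
  have e3 : D * 1 = o₁ * ⟪p, r⟫ + o₂ * ⟪q, r⟫ + o₃ * ⟪r, r⟫ := by
    have := congrArg (fun w => ⟪w, r⟫) hexp
    simpa only [real_inner_smul_left, inner_add_left, hcr] using this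
  have e4 : D * ⟪c, x⟫ = o₁ * ⟪p, x⟫ + o₂ * ⟪q, x⟫ + o₃ * ⟪r, x⟫ := by
    have := congrArg (fun w => ⟪w, x⟫) hexp
    simpa only [real_inner_smul_left, inner_add_left] using this
  rw [hp1, real_inner_comm p q, real_inner_comm p r] at e1
  rw [hq1, real_inner_comm q r] at e2
  rw [hr1] at e3
  have hdet0 := gram_det_eq_orient3_sq p q r
  rw [hp1, hq1, hr1] at hdet0
  -- names for the inner products
  set a := ⟪p, q⟫ with ha
  set b := ⟪p, r⟫ with hb
  set d := ⟪q, r⟫ with hd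
  set g₁ := ⟪p, x⟫
  set g₂ := ⟪q, x⟫
  set g₃ := ⟪r, x⟫
  set t := ⟪c, x⟫
  -- adjugate entries of G = [[1,a,b],[a,1,d],[b,d,1]]
  have key : D * ((1 * (1 * 1 - d * d) - a * (a * 1 - d * b) + b * (a * d - 1 * b)) * t) =
      D * (((1 * 1 - d * d) + (d * b - a * 1) + (a * d - 1 * b)) * g₁ +
        ((b * d - a * 1) + (1 * 1 - b * b) + (a * b - 1 * d)) * g₂ +
        ((a * d - b * 1) + (b * a - 1 * d) + (1 * 1 - a * a)) * g₃) := by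
    linear_combination (1 * (1 * 1 - d * d) - a * (a * 1 - d * b) + b * (a * d - 1 * b)) * e4 -
      (g₁ * (1 - d * d) + g₂ * (b * d - a) + g₃ * (a * d - b)) * e1 -
      (g₁ * (b * d - a) + g₂ * (1 - b * b) + g₃ * (a * b - d)) * e2 -
      (g₁ * (a * d - b) + g₂ * (a * b - d) + g₃ * (1 - a * a)) * e3
  have key' := mul_left_cancel₀ hD key
  have hdet : 1 * (1 * 1 - d * d) - a * (a * 1 - d * b) + b * (a * d - 1 * b) = D ^ 2 := by
    linear_combination hdet0
  unfold cvxForm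
  rw [← key', hdet]
  have hD2 : 0 ≤ D ^ 2 := sq_nonneg D
  nlinarith [hD2, hcle]

end Summit.AtomisticToContinuum.Crystallization.Theorems

end
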